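import Summits.ResolutionOfSingularities.ResolutionOfSingularities.Theorems.PurelyInseparableDim4TorusEquivariance
import Summits.ResolutionOfSingularities.ResolutionOfSingularities.Theorems.PurelyInseparableDim4Target
import Summits.ResolutionOfSingularities.ResolutionOfSingularities.Theorems.PurelyInseparableDim4Rules
import Summits.ResolutionOfSingularities.ResolutionOfSingularities.Theorems.PurelyInseparableDim4NearDim
import Literature.AlgebraicGeometry.Resolution.CentreBlowupMohStability
import HarnessLib

/-!
# [OURS · res-dim4-pi] TORUS × UNIT EQUIVARIANCE OF THE MODEL, part 2 (cell words): edges, the step relations of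
  record and traps transport along the orbit `F ↦ c · F(νx)` (`c ∈ Kˣ`, `ν ∈ (Kˣ)⁴`)

Cell `res-dim4-pi` (D-0157 DOOR 2, wave 2), seat `res-dim4-p-6`; sequel of `PurelyInseparableDim4TorusEquivariance`
(part 1: `step_scale`, `step_C_mul`, `isEquimultiplePoint_scale_iff`, …) stated over the landed frame
`PurelyInseparableDim4Target` / `…Rules` (`State`, `IsPermissibleCentre`, `Perm2`, `IsMode1hCentre`, `Edge`,
`Step0 / Step1h / Step2 / StepHP`, `IsTrap`).  No definition: the scaled state is written
`⟨C c * aeval (fun i => C (ν i) * X i) s.F, s.r, s.exc⟩`.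

* §1 invariance of the predicates read on supports: `isPermissibleCentre_scale_iff`, `shade_scale`,
  `perm2_scale_iff`, `isMode1hCentre_scale_iff`.
* §2 **`edge_scale`**: an edge `s ⟶ s'` along `S` from a state with condition (1) transports to an edge from
  `c · s(νx)` to `c' · s'(μx)` for the CHART torus `μ` (`μ_j = ν_j`, `μ_i = ν_i/ν_j` on `S ∖ j`, `μ_i = ν_i` off `S`)
  and the unit `c' = c · ν_j^q`, at the chart point `b/μ`; hence `step0_scale`, `step1h_scale`, `step2_scale`,
  `stepHP_scale`.
* §3 **`isTrap_saturate`**: the saturation of a trap under all unit factors and unit torus elements is a trap —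
  the census may quotient its trap / cycle bookkeeping by `S₄ ⋉ (Kˣ)⁴` and units (with part 1 of
  `PurelyInseparableDim4Equivariance` for the `S₄` factor) for every RELATION of record.

Scope (honest): relations only — a centre RULE that reads coefficients need not be torus-equivariant; the torus
CHANGES along a branch (chart by chart), so «the same configuration up to scaling» is a statement about single
edges and about sets closed under all scalings, not about literal equality of branches.  [OURS · counted 0 ·
elementary · AI kernel work, weaker than expert review.]  NOTHING here is a statement about resolution of
singularities; resolution in dimension `≥ 4` / characteristic `p > 0` is NOT proved by anything in this file.
bears_on: LADDER-RESOLUTION:D157-DOOR2 (res-dim4-pi).  Host item (DR-157-C): `stmt-ResolutionOfSingularities-16155`.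
-/

noncomputable section

set_option linter.dupNamespace false -- mandated namespace of this single-conjunct summit

open MvPolynomial Finset

open scoped BigOperators

namespace Summit.ResolutionOfSingularities.ResolutionOfSingularities.Theorems.PIDim4

namespace Torus

open Literature.AlgebraicGeometry.Resolution
open Literature.AlgebraicGeometry.Resolution.CentreBlowup
open Literature.AlgebraicGeometry.Resolution.Hauser2010

variable {K : Type} [Field K] [DecidableEq K]

/-! ## §1 The predicates read on supports are invariant -/

omit [DecidableEq K] in
/-- The support of `c · F(νx)` is the support of `F` (units). [folklore] -/
theorem support_C_mul_scale {c : K} (hc : c ≠ 0) {ν : Fin 4 → K} (hν : ∀ i, ν i ≠ 0)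
    (F : MvPolynomial (Fin 4) K) : (C c * aeval (fun i => C (ν i) * X i) F).support = F.support := by
  rw [support_C_mul hc, support_scale hν]

omit [DecidableEq K] in
/-- `ordAlong` is invariant under `F ↦ c · F(νx)`. [cite: HauserPerlega2019PRIMS, §2 (ord_P)] -/
theorem ordAlong_C_mul_scale {c : K} (hc : c ≠ 0) {ν : Fin 4 → K} (hν : ∀ i, ν i ≠ 0) (S : Finset (Fin 4))
    (F : MvPolynomial (Fin 4) K) : ordAlong S (C c * aeval (fun i => C (ν i) * X i) F) = ordAlong S F := by
  unfold ordAlong; rw [support_C_mul_scale hc hν]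

omit [DecidableEq K] in
/-- Hironaka-permissibility is invariant. [cite: HauserPerlega2019PRIMS, §2 (condition (1))] -/
theorem isPermissibleCentre_scale_iff {c : K} (hc : c ≠ 0) {ν : Fin 4 → K} (hν : ∀ i, ν i ≠ 0) (q : ℕ)
    (S : Finset (Fin 4)) (F : MvPolynomial (Fin 4) K) :
    IsPermissibleCentre q S (C c * aeval (fun i => C (ν i) * X i) F) ↔ IsPermissibleCentre q S F := by
  unfold IsPermissibleCentre; rw [ordAlong_C_mul_scale hc hν]

omit [DecidableEq K] in
/-- The shade is invariant. [cite: Hauser2010, §F (definition of the shade)] -/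
theorem shade_scale {c : K} (hc : c ≠ 0) {ν : Fin 4 → K} (hν : ∀ i, ν i ≠ 0) (s : State K) :
    (⟨C c * aeval (fun i => C (ν i) * X i) s.F, s.r, s.exc⟩ : State K).shade = s.shade := by
  show ordZero (C c * aeval (fun i => C (ν i) * X i) s.F) - (s.r.degree : ℕ∞) = ordZero s.F - (s.r.degree : ℕ∞)
  rw [← ordAlong_univ, ← ordAlong_univ, ordAlong_C_mul_scale hc hν]

omit [DecidableEq K] in
/-- Condition (2) is invariant. [cite: HauserPerlega2019PRIMS, §2 (condition (2))] -/
theorem perm2_scale_iff {c : K} (hc : c ≠ 0) {ν : Fin 4 → K} (hν : ∀ i, ν i ≠ 0) (S : Finset (Fin 4))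
    (s : State K) : Perm2 S ⟨C c * aeval (fun i => C (ν i) * X i) s.F, s.r, s.exc⟩ ↔ Perm2 S s := by
  unfold Perm2
  rw [shade_scale hc hν]
  show _ + s.shade ≤ ordAlong S (C c * aeval (fun i => C (ν i) * X i) s.F) ↔ _
  rw [ordAlong_C_mul_scale hc hν]

omit [DecidableEq K] in
/-- The MODE-1h centre predicate is invariant. [cite: HauserPerlega2019PRIMS, §2 (permissible blowups)] -/
theorem isMode1hCentre_scale_iff {c : K} (hc : c ≠ 0) {ν : Fin 4 → K} (hν : ∀ i, ν i ≠ 0) (q : ℕ)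
    (S : Finset (Fin 4)) (F : MvPolynomial (Fin 4) K) :
    IsMode1hCentre q S (C c * aeval (fun i => C (ν i) * X i) F) ↔ IsMode1hCentre q S F := by
  unfold IsMode1hCentre
  simp only [isPermissibleCentre_scale_iff hc hν]

/-! ## §2 Edges and the step relations transport along the orbit -/

/-- **EDGES TRANSPORT ALONG THE TORUS-AND-UNIT ORBIT.**  If `s ⟶ s'` is an edge along `S` (condition (1) at `s`),
then for every unit `c` and unit torus element `ν` the scaled state `c · s(νx)` has an edge along `S` to
`c' · s'(μx)` with the chart torus `μ` (`μ_j = ν_j`, `μ_i = ν_i/ν_j` on `S ∖ j`, `μ_i = ν_i` off `S`; a unit) and the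
unit `c' = c · μ_j^q`, at the chart point `b/μ`. [folklore] -/
theorem edge_scale {q : ℕ} {S : Finset (Fin 4)} {s s' : State K} (hq : ∀ d ∈ s.F.support, q ≤ degIn S d)
    {c : K} (hc : c ≠ 0) {ν : Fin 4 → K} (hν : ∀ i, ν i ≠ 0) (h : Edge q S s s') :
    ∃ (c' : K) (μ : Fin 4 → K), c' ≠ 0 ∧ (∀ i, μ i ≠ 0) ∧
      Edge q S ⟨C c * aeval (fun i => C (ν i) * X i) s.F, s.r, s.exc⟩
        ⟨C c' * aeval (fun i => C (μ i) * X i) s'.F, s'.r, s'.exc⟩ := by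
  obtain ⟨j, b, hj, hbj, heq, hne, rfl⟩ := h
  -- the chart torus `μ` (opaque after `generalize`) and its two properties
  generalize hμ : (fun i => if i ∈ S ∧ i ≠ j then ν i / ν j else ν i) = μ
  have hμi : ∀ i, μ i = if i ∈ S ∧ i ≠ j then ν i / ν j else ν i := fun i => by rw [← hμ]
  have hμne : ∀ i, μ i ≠ 0 := fun i => by
    rw [hμi]
    split_ifs
    · exact div_ne_zero (hν i) (hν j)
    · exact hν i
  have hμj : μ j = ν j := by rw [hμi j, if_neg (fun h => h.2 rfl)]
  have hlam : ∀ i, ν i = if i ∈ S ∧ i ≠ j then μ i * μ j else μ i := fun i => by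
    by_cases h : i ∈ S ∧ i ≠ j
    · rw [if_pos h, hμi i, if_pos h, hμj, div_mul_cancel₀ _ (hν j)]
    · rw [if_neg h, hμi i, if_neg h]
  -- the chart point `b' = b/μ`, so that `b = μ • b'`
  obtain ⟨b', rfl⟩ : ∃ b' : Fin 4 → K, (fun i => μ i * b' i) = b :=
    ⟨fun i => b i / μ i, funext fun i => mul_div_cancel₀ _ (hμne i)⟩
  have hbj' : b' j = 0 := (mul_eq_zero_iff_of_ne hμne b' j).mp hbj
  refine ⟨c * μ j ^ q, μ, mul_ne_zero hc (pow_ne_zero _ (hμne j)), hμne, j, b', hj, hbj', ?_, ?_, ?_⟩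
  · rw [isEquimultiplePoint_C_mul_iff q S j hc b' _ s.r s.exc, isEquimultiplePoint_scale_iff hj hμne ν hlam b' s hq]
    exact heq
  · rw [step_C_mul q S j hc b' _ s.r s.exc, step_scale hj hμne ν hlam b' s hq]
    show C c * (C (μ j ^ q) * aeval (fun i => C (μ i) * X i)
      (CentreBlowup.step q S j (fun i => μ i * b' i) s).F) ≠ 0
    rw [← mul_assoc, ← map_mul]
    intro h0
    apply hne
    have hsupp := support_C_mul_scale (mul_ne_zero hc (pow_ne_zero q (hμne j))) hμne
      (CentreBlowup.step q S j (fun i => μ i * b' i) s).F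
    rw [h0, MvPolynomial.support_zero] at hsupp
    exact MvPolynomial.support_eq_empty.mp hsupp.symm
  · rw [step_C_mul q S j hc b' _ s.r s.exc, step_scale hj hμne ν hlam b' s hq, ← mul_assoc, ← map_mul]

/-- MODE-2 steps transport along the orbit. [folklore] -/
theorem step2_scale {q : ℕ} {s s' : State K} {c : K} (hc : c ≠ 0) {ν : Fin 4 → K} (hν : ∀ i, ν i ≠ 0)
    (h : Step2 q s s') :
    ∃ (c' : K) (μ : Fin 4 → K), c' ≠ 0 ∧ (∀ i, μ i ≠ 0) ∧
      Step2 q ⟨C c * aeval (fun i => C (ν i) * X i) s.F, s.r, s.exc⟩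
        ⟨C c' * aeval (fun i => C (μ i) * X i) s'.F, s'.r, s'.exc⟩ := by
  obtain ⟨S, hS, hE⟩ := h
  obtain ⟨c', μ, hc', hμ, hE'⟩ := edge_scale (NearDim.forall_le_degIn_of_le_ordAlong hS.2) hc hν hE
  exact ⟨c', μ, hc', hμ, S, (isPermissibleCentre_scale_iff hc hν q S s.F).mpr hS, hE'⟩

/-- MODE-1h steps transport along the orbit. [folklore] -/
theorem step1h_scale {q : ℕ} {s s' : State K} {c : K} (hc : c ≠ 0) {ν : Fin 4 → K} (hν : ∀ i, ν i ≠ 0)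
    (h : Step1h q s s') :
    ∃ (c' : K) (μ : Fin 4 → K), c' ≠ 0 ∧ (∀ i, μ i ≠ 0) ∧
      Step1h q ⟨C c * aeval (fun i => C (ν i) * X i) s.F, s.r, s.exc⟩
        ⟨C c' * aeval (fun i => C (μ i) * X i) s'.F, s'.r, s'.exc⟩ := by
  obtain ⟨S, hS, hE⟩ := h
  obtain ⟨c', μ, hc', hμ, hE'⟩ := edge_scale (NearDim.forall_le_degIn_of_le_ordAlong hS.1.2) hc hν hE
  exact ⟨c', μ, hc', hμ, S, (isMode1hCentre_scale_iff hc hν q S s.F).mpr hS, hE'⟩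

/-- HP-permissible steps transport along the orbit. [folklore] -/
theorem stepHP_scale {q : ℕ} {s s' : State K} {c : K} (hc : c ≠ 0) {ν : Fin 4 → K} (hν : ∀ i, ν i ≠ 0)
    (h : StepHP q s s') :
    ∃ (c' : K) (μ : Fin 4 → K), c' ≠ 0 ∧ (∀ i, μ i ≠ 0) ∧
      StepHP q ⟨C c * aeval (fun i => C (ν i) * X i) s.F, s.r, s.exc⟩
        ⟨C c' * aeval (fun i => C (μ i) * X i) s'.F, s'.r, s'.exc⟩ := by
  obtain ⟨S, hS, h2, hE⟩ := h
  obtain ⟨c', μ, hc', hμ, hE'⟩ := edge_scale (NearDim.forall_le_degIn_of_le_ordAlong hS.2) hc hν hE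
  exact ⟨c', μ, hc', hμ, S, (isPermissibleCentre_scale_iff hc hν q S s.F).mpr hS,
    (perm2_scale_iff hc hν S s).mpr h2, hE'⟩

/-- MODE-0 steps transport along the orbit. [folklore] -/
theorem step0_scale {q : ℕ} {s s' : State K} {c : K} (hc : c ≠ 0) {ν : Fin 4 → K} (hν : ∀ i, ν i ≠ 0)
    (h : Step0 q s s') :
    ∃ (c' : K) (μ : Fin 4 → K), c' ≠ 0 ∧ (∀ i, μ i ≠ 0) ∧
      Step0 q ⟨C c * aeval (fun i => C (ν i) * X i) s.F, s.r, s.exc⟩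
        ⟨C c' * aeval (fun i => C (μ i) * X i) s'.F, s'.r, s'.exc⟩ := by
  obtain ⟨hord, hE⟩ := h
  obtain ⟨c', μ, hc', hμ, hE'⟩ := edge_scale (NearDim.forall_le_degIn_of_le_ordAlong hord) hc hν hE
  refine ⟨c', μ, hc', hμ, ?_, hE'⟩
  show (q : ℕ∞) ≤ ordAlong Finset.univ (C c * aeval (fun i => C (ν i) * X i) s.F)
  rw [ordAlong_C_mul_scale hc hν]; exact hord

/-! ## §3 Traps saturate -/

/-- **THE TORUS-AND-UNIT SATURATION OF A TRAP IS A TRAP**: with every state of a trap also all `c · s(νx)`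
(`c`, `νᵢ` units) — player B keeps answering inside the saturated set, by `edge_scale`. [folklore] -/
theorem isTrap_saturate {q : ℕ} {T : Set (State K)} (hT : IsTrap q T) :
    IsTrap q {t : State K | ∃ s ∈ T, ∃ (c : K) (ν : Fin 4 → K), c ≠ 0 ∧ (∀ i, ν i ≠ 0) ∧
      t = ⟨C c * aeval (fun i => C (ν i) * X i) s.F, s.r, s.exc⟩} := by
  rintro t ⟨s, hs, c, ν, hc, hν, rfl⟩
  obtain ⟨hord, hall⟩ := hT s hs
  refine ⟨?_, fun S hS => ?_⟩
  · show (q : ℕ∞) ≤ ordAlong Finset.univ (C c * aeval (fun i => C (ν i) * X i) s.F)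
    rw [ordAlong_C_mul_scale hc hν]; exact hord
  · have hS0 : IsPermissibleCentre q S s.F := (isPermissibleCentre_scale_iff hc hν q S s.F).mp hS
    obtain ⟨s₁, hs₁, hedge⟩ := hall S hS0
    obtain ⟨c', μ, hc', hμ, hE'⟩ := edge_scale (NearDim.forall_le_degIn_of_le_ordAlong hS0.2) hc hν hedge
    exact ⟨_, ⟨s₁, hs₁, c', μ, hc', hμ, rfl⟩, hE'⟩

end Torus

end Summit.ResolutionOfSingularities.ResolutionOfSingularities.Theorems.PIDim4

end
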